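import Literature.MathematicalPhysics.QuantumManyBody.PeriodicBoseGas
import Mathlib.Analysis.Fourier.FourierTransform
import Mathlib.Analysis.InnerProductSpace.Laplacian
import Mathlib.Analysis.Calculus.BumpFunction.InnerProduct
import Mathlib.Analysis.Calculus.BumpFunction.Normed
import Mathlib.Analysis.Convolution
import Mathlib.MeasureTheory.Integral.Bochner.Set
import HarnessLib

/-!
# Fournais 2020, §§2–3: sliding localisation of the periodic Bose gas onto small boxes

Topic `Literature/MathematicalPhysics/QuantumManyBody`, sibling of `PeriodicBoseGas.lean`
(provefact `Literature.MathematicalPhysics.QuantumManyBody.BoseGas.Fournais2020_condensation`, layer below [Fournais2020, Thm. 3.1]).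
[Fournais2020, Thm. 1.2] (`Fournais2020_condensation`) reduces (Remark (1.10)–(1.12) and (3.3))
to Thm. 3.1, the lower bound `H_{ρ_μ,N} ≥ -4πρ_μ²aL³(1 + C₁(ρ_μa³)^{1/2})` for
`H_{ρ_μ,N} = ∑ᵢ(-Δᵢ - 2π²L⁻²Qᵢ) + ∑_{i<j} v^per(xᵢ-xⱼ) - 8πaρ_μN` on the torus `ℝ³/Lℤ³` (3.1).
The printed proof of Thm. 3.1 (pp. 14–16) has exactly four ingredients, vendored here with the
objects they speak about:

* `LSSY2005_scatteringSolution` — existence of the scattering solution `ω` of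
  `(-Δ + ½v)(1-ω) = 0` with `g := v(1-ω)`, `∫ g = 8πa` [Fournais2020, App. A (A.1)–(A.5);
  LSSY2005, App. C Thm. C.1]; used in (3.1) to write `8πaρ_μN = ρ_μ ∑ᵢ ∫ g(xᵢ-y)dy`.
* `Fournais2020_lemma32` — [Fournais2020, Lemma 3.2 (3.10)–(3.11)], the potential-energy sliding
  identity `-ρ_μ∑ᵢ∫g(xᵢ-y)dy + ∑_{i<j}v^per(xᵢ-xⱼ) = ℓ⁻³∫_Ω W_{u,N} du` for `2ℓ < L`.
* `Fournais2020_lemma33` — [Fournais2020, Lemma 3.3 (3.12)–(3.13) and (3.21)] (cf. [BrietzkeFournaisSolovej2020, Lemma 5.7]),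
  the kinetic-energy sliding inequality `ℓ⁻³∫_Ω T_u du ≤ -Δ^per - 2π²L⁻²Q_L` on `L²(Ω)`.
* `Fournais2020_eq317` — the display [Fournais2020, (3.17)]: for all `N` and all `u ∈ Ω`,
  `(H_{Λ(u)}(ρ_μ))_N = ∑ᵢ T_u^{(i)} + W_{u,N} ≥ -4πρ_μ²aℓ³ - C₀ρ_μ²aℓ³(ρ_μa³)^{1/2}` (3.15), which
  the paper obtains from the small-box Fock-space bound Thm. 2.1 (cf. [BrietzkeFournaisSolovej2020, Thm. 6.1]) by the
  unitary equivalences (3.16); Thm. 2.1 itself (second quantisation, Lemmas 2.2–2.4) is the deep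
  layer and is not restated here.

Thm. 3.1 is then (3.14): sum Lemma 3.3 over the particles, add Lemma 3.2, insert (3.17) under
`ℓ⁻³∫_Ω du` (`|Ω| = L³`) — an `N`-body Fubini argument left to the proofs file.

## Rendering (all quadratic forms `ℝ≥0∞`-valued, as in `PeriodicBoseGas.lean`)

* **Boxes.** `ℓ = (K√(ρ_μa))⁻¹` (2.1); `Λ(u) = u + [-ℓ/2, ℓ/2]³ ⊂ ℝ³` (`slidingBox`, (3.4)); for
  `2ℓ < L` it projects injectively into the torus, and a periodic function restricted to it is the
  torus function restricted to `Λ(u) ⊂ Ω` ("identifying `L²(Λ(u)) ⊂ L²(Ω)` with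
  `L²(Λ(u)) ⊂ L²(ℝ³)`", p. 16). Our fundamental cell is `[0,L)³` (`cell L`); the paper's is
  `(-L/2,L/2)³`; every object below is `Lℤ³`-periodic in `u`, so `∫_Ω du` is the same.
* **Localisation function** `χ ∈ C_c^∞((-½,½)³)`, even, `0 ≤ χ`, `∫χ² = 1` (2.2)
  (`IsLocalizationFunction`, inhabited: `exists_isLocalizationFunction`); `χ_u(x) = χ((x-u)/ℓ)`
  (3.6) (`locFun`; we follow (3.4)/(3.6), where `u` is a point of `Ω`, not the dimensionless
  `ℓu` of [BrietzkeFournaisSolovej2020, (5.4)] that survives in the sentence after (3.9)); `χ_u^per = ∑_{j∈ℤ³} χ_u(· + Lj)`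
  (`locFunPer`, "similarly for `χ_u`" after (3.7)).
* **Potentials.** `W = v/(χ*χ)(x/ℓ)` (2.4) (`bigW`; `ℝ≥0∞` division, meaningful where
  `(χ*χ)(x/ℓ) > 0` on `supp v`, i.e. `R/ℓ` small — hypothesis (5.9) of [BrietzkeFournaisSolovej2020], "W is
  well-defined if `ρ_μa³` is sufficiently small", p. 5), `W₁ = g/(χ*χ)(x/ℓ)`, `g = v(1-ω)` (2.8)
  (`bigW₁`), their periodisations (3.7) (`bigWPer`, `bigW₁Per`), and
  `w_u^per(x,y) = χ_u^per(x) W^per(x-y) χ_u^per(y)` (3.9) (`pairLocPer`), `w_{1,u}^per` likewise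
  (`pairLoc₁Per`). `W_{u,N} = -ρ_μ∑ᵢ∫_Ω w^per_{1,u}(xᵢ,y)dy + ∑_{i<j} w_u^per(xᵢ,xⱼ)` (3.11) is
  kept as its two non-negative parts `attrLocN` (the `ρ_μ`-term) and `repLocN`.
* **Kinetic localisation.** `Q_u φ = θ_u φ - ℓ⁻³⟨θ_u,φ⟩θ_u` (3.5) (`projQ`) and
  `T_u = Q_u^*(χ_u[-Δ - s⁻²ℓ⁻²]₊χ_u + bℓ⁻²)Q_u` (3.13) (cf. [BrietzkeFournaisSolovej2020, (5.22)]) as the quadratic form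
  `⟨φ,T_uφ⟩ = ∫ (4π²|p|² - (sℓ)⁻²)₊ |𝓕(χ_u Q_uφ)(p)|² dp + bℓ⁻²‖Q_uφ‖²` (`kinLoc`), with Mathlib's
  unitary Fourier transform `𝓕f(p) = ∫ e^{-2πi⟨x,p⟩} f(x) dx`, under which `-Δ` is multiplication
  by `4π²|p|²` (the paper's `(2π)⁻³∫ … dp` convention has `p²`; same operator). On `N`-body
  functions, `⟨Ψ, T_u^{(i)}Ψ⟩ = ∫_{Ω^{N-1}} ⟨Ψ(…,·ᵢ,…), T_u Ψ(…,·ᵢ,…)⟩ dX̂ᵢ`, written as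
  `L⁻³ ∫_{Ω^N} (T_u of the i-th slice through X) dX` (the integrand does not depend on `xᵢ`)
  (`kinLocN`).
* `χ*χ` is Mathlib's convolution `χ ⋆ χ` (`selfConv`, pairing `lsmul ℝ ℝ`, Lebesgue measure), so
  that its support, continuity and evenness are Mathlib's (`support_convolution_subset`,
  `HasCompactSupport.continuous_convolution_right`, `convolution_neg_of_neg_eq`).
* `|∇φ|²` for complex one-body `φ` is `gradSqC` (sum of squared partial derivatives, as
  `kineticDensity`) — it is `gradSq` of `PeriodicBoseGas.lean` verbatim at codomain `ℂ`; the two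
  should be merged by generalising `gradSq` to a normed `ℝ`-codomain (refactor requested), after
  which `gradSqC := gradSq`. `‖P_Ωφ‖² = L⁻³|∫_Ω φ|²`, `‖Q_Ωφ‖² = ‖φ‖² - ‖P_Ωφ‖²` written additively.
* **Misprint.** (3.12) prints `-Δ^per - 2πL⁻²Q_L`; the gap of `-Δ^per` is `(2π/L)²`, (1.11) and
  the proof ((3.21): `F(k) ≤ k² - 2π²L⁻²`) have `2π²L⁻²`, which is what we vendor.
* Constants are quantified after everything they may depend on (weakest reading): in (3.17),
  `K₀` after `v, ω, χ, b, s`; `C₀, c` after `K` ("`K` sufficiently large (depending only on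
  `χ, b, s, R`) … there exists `C₀` … for sufficiently small `ρ_μa³`", Thm. 2.1; "`C` depending on
  `Ξ` and on `K`", (2.47)).

## References

* [Fournais2020] S. Fournais, *Length scales for BEC in the dilute Bose gas*, arXiv:2011.00309,
  EMS Ser. Congr. Rep. 18 (2021), doi:10.4171/ecr/18-1/7: (2.1)–(2.11), Thm. 2.1, (3.1)–(3.17),
  Lemmas 3.2–3.3, App. A (A.1)–(A.6).
* [BrietzkeFournaisSolovej2020] B. Brietzke, S. Fournais, J. P. Solovej, *A simple 2nd order lower bound to the
  energy of dilute Bose gases*, Comm. Math. Phys. 376 (2020) 323–351, arXiv:1901.00539: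
  (5.1)–(5.12), (5.22), Lemmas 5.2, 5.7, (5.33)–(5.35), Thm. 6.1.
* [LSSY2005] E. H. Lieb, R. Seiringer, J. P. Solovej, J. Yngvason, *The Mathematics of the Bose
  Gas and its Condensation*, Birkhäuser 2005: App. C, Thm. C.1, (C.1)–(C.8).
-/

noncomputable section

open MeasureTheory Filter Metric WithLp
open scoped ENNReal NNReal FourierTransform Laplacian Convolution

namespace Literature.MathematicalPhysics.QuantumManyBody.BoseGas

/-! ### The scattering solution -/

/-- `ω` is **the scattering solution** of the radial pair potential `v` (Assumption 1.1):
`(-Δ + ½v)(1 - ω) = 0` on `ℝ³` in the sense of distributions with `ω → 0` at infinity (A.1),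
`0 ≤ ω ≤ 1` (A.2), `ω` radial, `ω(x) = a/|x|` outside the support of `v` where `a` is the
scattering length (here: beyond every radius `R₀` past which `v` vanishes, `a = scatteringLength v`,
the variational scattering length of LSSY (C.4)–(C.8)), and `∫ g = 8πa` for `g := v(1 - ω)`
(A.4)–(A.5). Meaningful only for a.e.-finite `v`: the weak equation is written with `(v|x|).toReal`,
to which a hard core (`v = ⊤` on a set of positive measure) is invisible, and then, with `eq_div`,
no `ω` exists once `a > 0`; both consumers (`LSSY2005_scatteringSolution`, `Fournais2020_eq317`)
assume `∫ v < ∞`. (A.2) also prints "radially symmetric and non-increasing"; monotonicity is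
omitted here on purpose (a weakening; uniqueness of `ω` still follows from `weak_eq`, `eq_div` and
`0 ≤ ω ≤ 1`). [cite: Fournais2020, App. A (A.1)–(A.5)] -/
structure IsScatteringSolution (v : ℝ → ℝ≥0∞) (ω : Space → ℝ) : Prop where
  /-- `ω` is measurable. -/
  measurable : Measurable ω
  /-- `0 ≤ ω` (A.2). -/
  nonneg : ∀ x, 0 ≤ ω x
  /-- `ω ≤ 1` (A.2). -/
  le_one : ∀ x, ω x ≤ 1
  /-- `ω` is radially symmetric. -/
  radial : ∀ x y : Space, ‖x‖ = ‖y‖ → ω x = ω y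
  /-- `ω(x) = a/|x|` outside the support of `v`. -/
  eq_div : ∀ R₀ : ℝ, (∀ r, R₀ < r → v r = 0) →
    ∀ x : Space, R₀ < ‖x‖ → ω x = (scatteringLength v).toReal / ‖x‖
  /-- The scattering equation (A.1) `(-Δ + ½v)(1-ω) = 0` in `𝒟'(ℝ³)`:
  `∫ (1-ω) Δφ = ½ ∫ v (1-ω) φ` for every real test function `φ`. -/
  weak_eq : ∀ φ : Space → ℝ, ContDiff ℝ (⊤ : ℕ∞) φ → HasCompactSupport φ →
    ∫ x, (1 - ω x) * (Δ φ) x = 2⁻¹ * ∫ x, (v ‖x‖).toReal * (1 - ω x) * φ x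
  /-- (A.5): `∫ g = 8πa`, `g = v(1-ω)` (A.4). -/
  lintegral_g : ∫⁻ x : Space, v ‖x‖ * ENNReal.ofReal (1 - ω x) =
    ENNReal.ofReal (8 * Real.pi) * scatteringLength v

/-- **Existence of the scattering solution** (LSSY App. C, Thm. C.1; Fournais App. A). For a
non-negative radial potential of finite range which is integrable on `ℝ³` (Assumption 1.1; then
`a < ∞`), the scattering equation `(-Δ + ½v)(1-ω) = 0`, `ω → 0` at infinity, has a radial
solution with `0 ≤ ω ≤ 1`, `ω(x) = a/|x|` outside `supp v` for the scattering length `a` of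
(C.4)–(C.8), and `a = (8π)⁻¹∫ v(1-ω)`. (LSSY prove existence, uniqueness and these properties of
the minimiser `φ₀ = 1 - ω` of the scattering functional; `4πa = inf` over `C¹` functions equal
to `1` near infinity — our `scatteringLength` — by (C.8), `min E_R = 4πa/(1-a/R) ↓ 4πa`.)
[cite: LSSY2005, App. C Thm. C.1 (C.1)–(C.8); Fournais2020, App. A (A.1)–(A.5)] -/
def LSSY2005_scatteringSolution : Prop :=
  ∀ v : ℝ → ℝ≥0∞, IsRepulsiveFiniteRange v → (∫⁻ x : Space, v ‖x‖) ≠ ⊤ →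
    ∃ ω : Space → ℝ, IsScatteringSolution v ω

/-! ### Localisation function and boxes -/

/-- A **localisation function**: `χ ∈ C_c^∞((-½,½)³)`, even, `0 ≤ χ`, `∫ χ² = 1` (2.2).
[cite: Fournais2020, (2.2) and Thm. 2.1] -/
structure IsLocalizationFunction (χ : Space → ℝ) : Prop where
  /-- `χ` is smooth. -/
  contDiff : ContDiff ℝ (⊤ : ℕ∞) χ
  /-- `supp χ ⊂ (-½, ½)³`. -/
  tsupport_subset : tsupport χ ⊆ {x | ∀ k, |x k| < 2⁻¹}
  /-- `χ` is even. -/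
  even : ∀ x, χ (-x) = χ x
  /-- `0 ≤ χ`. -/
  nonneg : ∀ x, 0 ≤ χ x
  /-- `∫ χ² = 1`. -/
  integral_sq : ∫ x, χ x ^ 2 = 1

/-- The side `ℓ = K⁻¹ (ρ_μ a)^{-1/2}` of the small boxes (2.1). [cite: Fournais2020, (2.1)] -/
def boxLength (K ρμ a : ℝ) : ℝ :=
  (K * Real.sqrt (ρμ * a))⁻¹

/-- The sliding box `Λ(u) = u + [-ℓ/2, ℓ/2]³ ⊂ ℝ³` (3.4). [cite: Fournais2020, (3.4)] -/
def slidingBox (ℓ : ℝ) (u : Space) : Set Space :=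
  {x | ∀ k, x k - u k ∈ Set.Icc (-ℓ / 2) (ℓ / 2)}

/-- `χ_u(x) = χ((x - u)/ℓ) = χ_Λ(x - u)` (3.6), (2.3). [cite: Fournais2020, (3.6)] -/
def locFun (χ : Space → ℝ) (ℓ : ℝ) (u x : Space) : ℝ :=
  χ (ℓ⁻¹ • (x - u))

/-- The periodised localisation function `χ_u^per(x) = ∑_{j∈ℤ³} χ_u(x + Lj)` (in `[0,∞]`; for
`ℓ < L` at most one term is non-zero). [cite: Fournais2020, (3.7)] -/
def locFunPer (χ : Space → ℝ) (ℓ L : ℝ) (u x : Space) : ℝ≥0∞ :=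
  ∑' n : Fin 3 → ℤ, ENNReal.ofReal (locFun χ ℓ u (x + latticeVec L n))

/-- The self-convolution `χ*χ := χ ⋆ χ`, Mathlib's `convolution` for the multiplication pairing
`lsmul ℝ ℝ` and Lebesgue measure: `(χ*χ)(y) = ∫ χ(t) χ(y - t) dt = ∫ χ(y - z) χ(z) dz`
(`selfConv_apply`). [cite: Fournais2020, (2.4)] -/
def selfConv (χ : Space → ℝ) : Space → ℝ :=
  χ ⋆ χ

/-- `(χ*χ)(y) = ∫ χ(y - z) χ(z) dz`. [cite: Fournais2020, (2.4)] -/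
theorem selfConv_apply (χ : Space → ℝ) (y : Space) : selfConv χ y = ∫ z, χ (y - z) * χ z := by
  simp only [selfConv, convolution_lsmul_swap, smul_eq_mul]

/-- `W(x) = v(x) / (χ*χ)(x/ℓ)` (2.4), for the radial profile `v` (`ℝ≥0∞`-valued; where
`(χ*χ)(x/ℓ) ≤ 0` the `ℝ≥0∞` conventions `c/0 = ⊤`, `0/0 = 0` apply — the facts below assume
`(χ*χ)(x/ℓ) > 0` on `supp v`). [cite: Fournais2020, (2.4)] -/
def bigW (v : ℝ → ℝ≥0∞) (χ : Space → ℝ) (ℓ : ℝ) (x : Space) : ℝ≥0∞ :=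
  v ‖x‖ / ENNReal.ofReal (selfConv χ (ℓ⁻¹ • x))

/-- `W₁(x) = W(x)(1 - ω(x)) = g(x)/(χ*χ)(x/ℓ)`, `g = v(1-ω)` (2.8), (A.4). [cite: Fournais2020, (2.8)] -/
def bigW₁ (v : ℝ → ℝ≥0∞) (ω : Space → ℝ) (χ : Space → ℝ) (ℓ : ℝ) (x : Space) : ℝ≥0∞ :=
  v ‖x‖ * ENNReal.ofReal (1 - ω x) / ENNReal.ofReal (selfConv χ (ℓ⁻¹ • x))

/-- `W^per(x) = ∑_{j∈ℤ³} W(x + Lj)` (3.7). [cite: Fournais2020, (3.7)] -/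
def bigWPer (v : ℝ → ℝ≥0∞) (χ : Space → ℝ) (ℓ L : ℝ) (x : Space) : ℝ≥0∞ :=
  ∑' n : Fin 3 → ℤ, bigW v χ ℓ (x + latticeVec L n)

/-- `W₁^per(x) = ∑_{j∈ℤ³} W₁(x + Lj)` (3.7)–(3.9). [cite: Fournais2020, (3.7)] -/
def bigW₁Per (v : ℝ → ℝ≥0∞) (ω : Space → ℝ) (χ : Space → ℝ) (ℓ L : ℝ) (x : Space) : ℝ≥0∞ :=
  ∑' n : Fin 3 → ℤ, bigW₁ v ω χ ℓ (x + latticeVec L n)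

/-- The localised periodic pair potential `w_u^per(x,y) = χ_u^per(x) W^per(x-y) χ_u^per(y)` (3.9).
[cite: Fournais2020, (3.9)] -/
def pairLocPer (v : ℝ → ℝ≥0∞) (χ : Space → ℝ) (ℓ L : ℝ) (u x y : Space) : ℝ≥0∞ :=
  locFunPer χ ℓ L u x * bigWPer v χ ℓ L (x - y) * locFunPer χ ℓ L u y

/-- `w_{1,u}^per(x,y) = χ_u^per(x) W₁^per(x-y) χ_u^per(y)` (2.8), (3.9). [cite: Fournais2020, (3.9)] -/
def pairLoc₁Per (v : ℝ → ℝ≥0∞) (ω : Space → ℝ) (χ : Space → ℝ) (ℓ L : ℝ) (u x y : Space) :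
    ℝ≥0∞ :=
  locFunPer χ ℓ L u x * bigW₁Per v ω χ ℓ L (x - y) * locFunPer χ ℓ L u y

/-- The attractive part `ρ_μ ∑ᵢ ∫_Ω w_{1,u}^per(xᵢ, y) dy` of `W_{u,N}` (3.11) at the configuration
`X`. [cite: Fournais2020, (3.11)] -/
def attrLocN {N : ℕ} (v : ℝ → ℝ≥0∞) (ω : Space → ℝ) (χ : Space → ℝ) (ℓ L ρμ : ℝ) (u : Space)
    (X : Config N) : ℝ≥0∞ :=
  ENNReal.ofReal ρμ * ∑ i : Fin N, ∫⁻ y in cell L, pairLoc₁Per v ω χ ℓ L u (X i) y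

/-- The repulsive part `∑_{i<j} w_u^per(xᵢ, xⱼ)` of `W_{u,N}` (3.11) at the configuration `X`.
[cite: Fournais2020, (3.11)] -/
def repLocN {N : ℕ} (v : ℝ → ℝ≥0∞) (χ : Space → ℝ) (ℓ L : ℝ) (u : Space) (X : Config N) : ℝ≥0∞ :=
  ∑ i : Fin N, ∑ j : Fin N with i < j, pairLocPer v χ ℓ L u (X i) (X j)

/-! ### Kinetic localisation -/

/-- `Q_u φ = θ_u φ - ℓ⁻³⟨θ_u, φ⟩ θ_u` (3.5): restriction to the box `Λ(u)` minus the box average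
(`θ_u = 1_{Λ(u)}` (3.4)); the range of `Q_u` is `L²(Λ(u)) ⊖ {constants}` viewed in `L²(ℝ³)`.
[cite: Fournais2020, (3.4)–(3.5)] -/
def projQ (ℓ : ℝ) (u : Space) (φ : Space → ℂ) : Space → ℂ :=
  (slidingBox ℓ u).indicator fun x => φ x - ((ℓ ^ 3)⁻¹ : ℝ) • ∫ y in slidingBox ℓ u, φ y

/-- The quadratic form `⟨φ, T_u φ⟩` of the localised kinetic energy
`T_u = Q_u^* (χ_u [-Δ - s⁻²ℓ⁻²]₊ χ_u + b ℓ⁻²) Q_u` (3.13) (cf. [BrietzkeFournaisSolovej2020, (5.22)], which has a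
universal constant `C_kin ℓ⁻²` in place of `s⁻²ℓ⁻²`), `Δ` the Laplacian
of `ℝ³`: `∫ (4π²|p|² - (sℓ)⁻²)₊ |𝓕(χ_u Q_u φ)(p)|² dp + bℓ⁻² ‖Q_u φ‖²` with Mathlib's Fourier
transform `𝓕f(p) = ∫ e^{-2πi⟨x,p⟩} f`, for which `-Δ = 𝓕⁻¹ 4π²|p|² 𝓕` (`ENNReal.ofReal` takes the
positive part). [cite: Fournais2020, (3.13) and (2.7)] -/
def kinLoc (χ : Space → ℝ) (ℓ s b : ℝ) (u : Space) (φ : Space → ℂ) : ℝ≥0∞ :=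
  (∫⁻ p : Space, ENNReal.ofReal (4 * Real.pi ^ 2 * ‖p‖ ^ 2 - (s * ℓ)⁻¹ ^ 2) *
      (‖𝓕 (fun x => (locFun χ ℓ u x : ℂ) * projQ ℓ u φ x) p‖₊ : ℝ≥0∞) ^ 2) +
    ENNReal.ofReal (b / ℓ ^ 2) * ∫⁻ x, (‖projQ ℓ u φ x‖₊ : ℝ≥0∞) ^ 2

/-- `∑ᵢ ⟨Ψ, T_u^{(i)} Ψ⟩` for an `N`-body wave function on the torus of side `L` (3.15):
`T_u` acting on the `i`-th particle, the others integrated over the cell, written as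
`L⁻³ ∫_{Ω^N} ⟨Ψ(X; ·ᵢ), T_u Ψ(X; ·ᵢ)⟩ dX` where `Ψ(X; ·ᵢ) = x ↦ Ψ(x₁,…,x_{i-1},x,x_{i+1},…)` (the
integrand is independent of `xᵢ ∈ Ω`, whence the factor `L⁻³`). [cite: Fournais2020, (3.15)] -/
def kinLocN {N : ℕ} (χ : Space → ℝ) (ℓ s b : ℝ) (u : Space) (L : ℝ) (Ψ : Config N → ℂ) : ℝ≥0∞ :=
  ∑ i : Fin N, (ENNReal.ofReal L ^ 3)⁻¹ *
    ∫⁻ X in cellN N L, kinLoc χ ℓ s b u fun x => Ψ (Function.update X i x)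

/-- `|∇φ(x)|² = ∑ₖ |∂ₖφ(x)|²` for a complex one-body function (as `kineticDensity` with `N = 1`).
This is `gradSq` (`PeriodicBoseGas.lean`, codomain `ℝ`) verbatim at codomain `ℂ`; one definition
should survive: generalise `gradSq` to a normed `ℝ`-codomain (librarian refactor requested) and
then set `gradSqC := gradSq`. [cite: Fournais2020, (1.1)] -/
def gradSqC (φ : Space → ℂ) (x : Space) : ℝ≥0∞ :=
  ∑ k : Fin 3, (‖fderiv ℝ φ x (EuclideanSpace.single k (1 : ℝ))‖₊ : ℝ≥0∞) ^ 2

/-! ### Named facts: the ingredients of the proof of Theorem 3.1 -/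

/-- **Fournais 2020, Lemma 3.2** (potential-energy localisation). For `2ℓ < L` (and, as
throughout §3, `R < ℓ` with `W` well defined, i.e. `(χ*χ)(y) > 0` for `|y| ≤ R/ℓ`, [BrietzkeFournaisSolovej2020,
(5.8)–(5.9)]): `-ρ_μ ∑ᵢ ∫ g(xᵢ-y)dy + ∑_{i<j} v^per(xᵢ-xⱼ) = ℓ⁻³ ∫_Ω W_{u,N} du` (3.10) with
`W_{u,N} = -ρ_μ ∑ᵢ ∫_Ω w^per_{1,u}(xᵢ,y)dy + ∑_{i<j} w_u^per(xᵢ,xⱼ)` (3.11), as functions of the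
configuration ("by direct calculation of the `u`-integral": `χ` even and `supp χ ⊂ (-½,½)³` give
`ℓ⁻³∫_Ω χ_u^per(x)χ_u^per(y)du = ∑_{k∈ℤ³} (χ*χ)((x-y+Lk)/ℓ)`, of which only `k = 0` survives for
`|x-y| ≤ R ≤ ℓ`, `2ℓ < L`, and `(χ*χ) > 0` on `B̄(0,R/ℓ)` then cancels the denominator of `W`;
`∫χ² = 1` is not used). Vendored
as the two identities of non-negative functions it consists of (pair part and one-body part;
`g = v(1-ω) ≥ 0`). [cite: Fournais2020, Lemma 3.2 (3.10)–(3.11)] -/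
def Fournais2020_lemma32 : Prop :=
  ∀ (v : ℝ → ℝ≥0∞) (R : ℝ), Measurable v → (∀ r, R ≤ r → v r = 0) →
  ∀ (ω : Space → ℝ), Measurable ω →
  ∀ (χ : Space → ℝ), IsLocalizationFunction χ →
  ∀ (ℓ L : ℝ), 0 < ℓ → R ≤ ℓ → 2 * ℓ < L → (∀ y : Space, ‖y‖ ≤ R / ℓ → 0 < selfConv χ y) →
  ∀ (N : ℕ) (X : Config N),
    periodicInteraction v L X =
        (ENNReal.ofReal ℓ ^ 3)⁻¹ * ∫⁻ u in cell L, repLocN v χ ℓ L u X ∧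
    ∀ ρμ : ℝ, 0 ≤ ρμ →
      ENNReal.ofReal ρμ * ∑ i : Fin N, ∫⁻ y : Space, v ‖X i - y‖ * ENNReal.ofReal (1 - ω (X i - y)) =
        (ENNReal.ofReal ℓ ^ 3)⁻¹ * ∫⁻ u in cell L, attrLocN v ω χ ℓ L ρμ u X

/-- **Fournais 2020, Lemma 3.3** (kinetic-energy localisation; cf. [BrietzkeFournaisSolovej2020, Lemma 5.7]).
Assume `2ℓ < L`. There exists `b > 0` such that, if `s` is small enough,
`ℓ⁻³ ∫_Ω T_u du ≤ -Δ^per - 2π²L⁻² Q_L` (3.12) as quadratic forms on `L²(Ω)`, `Ω = ℝ³/Lℤ³`, with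
`T_u` of (3.13) and `Q_L = 1 - P_L`, `P_L = L⁻³|1⟩⟨1|` (1.3). ((3.12) is printed with `2πL⁻²`; the
gap is `2π²L⁻²` as in (1.11) and (3.21).) On `C¹` periodic `φ` (a form core), additively:
`ℓ⁻³∫_Ω ⟨φ,T_uφ⟩du + 2π²L⁻²‖φ‖² ≤ ∫_Ω|∇φ|² + 2π²L⁻² · L⁻³|∫_Ω φ|²`; `b, s₀` may depend on `χ`.
(The printed evidence for the gap `2π²L⁻²` is (3.21): `F(k) ≤ k² - 2π²L⁻²` for
`k ∈ 2πL⁻¹ℤ³ ∖ {0}`. [BrietzkeFournaisSolovej2020, Lemma 5.7] as printed is the `H¹₀(Λ)` whole-space version with no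
periodic gap term — a supporting cite only.)
[cite: Fournais2020, Lemma 3.3 (3.12)–(3.13) and (3.21)] [cite: BrietzkeFournaisSolovej2020, Lemma 5.7] -/
def Fournais2020_lemma33 : Prop :=
  ∀ χ : Space → ℝ, IsLocalizationFunction χ →
  ∃ b s₀ : ℝ, 0 < b ∧ 0 < s₀ ∧ ∀ s : ℝ, 0 < s → s ≤ s₀ →
    ∀ (ℓ L : ℝ), 0 < ℓ → 2 * ℓ < L →
    ∀ φ : Space → ℂ, ContDiff ℝ 1 φ → (∀ (x : Space) (k : Fin 3), φ (x + EuclideanSpace.single k L) = φ x) →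
      (ENNReal.ofReal ℓ ^ 3)⁻¹ * (∫⁻ u in cell L, kinLoc χ ℓ s b u φ) +
          ENNReal.ofReal (2 * Real.pi ^ 2 / L ^ 2) * ∫⁻ x in cell L, (‖φ x‖₊ : ℝ≥0∞) ^ 2 ≤
        (∫⁻ x in cell L, gradSqC φ x) +
          ENNReal.ofReal (2 * Real.pi ^ 2 / L ^ 2) *
            ((ENNReal.ofReal L ^ 3)⁻¹ * (‖∫ x in cell L, φ x‖₊ : ℝ≥0∞) ^ 2)

/-- **Fournais 2020, (3.17)** (the small-box bound on the sliding boxes of the torus). Let `v`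
satisfy Assumption 1.1 with scattering solution `ω`, fix a localisation function `χ` and the
constants `b, s > 0` of `T_u`. If `K` in `ℓ = (K√(ρ_μa))⁻¹` (2.1) is large enough, there is `C₀`
such that for `ρ_μa³` small enough, on the torus `ℝ³/Lℤ³` (`2ℓ < L`), for all `N` and all `u ∈ Ω`,
`(H_{Λ(u)}(ρ_μ))_N = ∑ᵢ T_u^{(i)} + W_{u,N} ≥ -4πρ_μ²aℓ³ - C₀ρ_μ²aℓ³(ρ_μa³)^{1/2}` (3.15), (3.17)
— by (3.16) these operators are unitarily equivalent to the box Hamiltonian `H_Λ(ρ_μ)` (2.6),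
for which this is Thm. 2.1 (2.11) (cf. [BrietzkeFournaisSolovej2020, Thm. 6.1], which is stated for `K = K₀` and
carries an extra `-Cρ_μ³a²R²`). As a form inequality on normalised
periodic `C¹` states, additively (`W_{u,N} = repLocN - attrLocN`).
[cite: Fournais2020, (3.15)–(3.17) and Thm. 2.1 (2.11)] [cite: BrietzkeFournaisSolovej2020, Thm. 6.1] -/
def Fournais2020_eq317 : Prop :=
  ∀ (v : ℝ → ℝ≥0∞), IsRepulsiveFiniteRange v → (∫⁻ x : Space, v ‖x‖) ≠ ⊤ →
    0 < scatteringLength v →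
  ∀ (ω : Space → ℝ), IsScatteringSolution v ω →
  ∀ (χ : Space → ℝ), IsLocalizationFunction χ →
  ∀ (b s : ℝ), 0 < b → 0 < s →
  ∃ K₀ : ℝ, 0 < K₀ ∧ ∀ K : ℝ, K₀ ≤ K →
  ∃ C₀ c : ℝ, 0 < C₀ ∧ 0 < c ∧
    ∀ (ρμ : ℝ) (N : ℕ) (L : ℝ), 0 < ρμ → 0 < L →
      let a := (scatteringLength v).toReal
      let ℓ := boxLength K ρμ a
      ρμ * a ^ 3 ≤ c → 2 * ℓ < L →
      ∀ u ∈ cell L, ∀ Ψ : PeriodicTrialState N L,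
        (∫⁻ X in cellN N L, attrLocN v ω χ ℓ L ρμ u X * (‖Ψ.ψ X‖₊ : ℝ≥0∞) ^ 2) ≤
          kinLocN χ ℓ s b u L Ψ.ψ +
            (∫⁻ X in cellN N L, repLocN v χ ℓ L u X * (‖Ψ.ψ X‖₊ : ℝ≥0∞) ^ 2) +
            ENNReal.ofReal
              (4 * Real.pi * ρμ ^ 2 * a * ℓ ^ 3 * (1 + C₀ * (ρμ * a ^ 3) ^ (1 / 2 : ℝ)))

/-! ### Basic API -/

/-- A localisation function has compact support (`supp χ ⊂ (-½,½)³ ⊂ B̄(0,1)`).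
[cite: Fournais2020, (2.2)] -/
theorem IsLocalizationFunction.hasCompactSupport {χ : Space → ℝ} (hχ : IsLocalizationFunction χ) :
    HasCompactSupport χ := by
  refine IsCompact.of_isClosed_subset (isCompact_closedBall (0 : Space) 1) (isClosed_tsupport χ)
    fun x hx => ?_
  have hk := hχ.tsupport_subset hx
  rw [mem_closedBall, dist_zero_right]
  have h2 : ‖x‖ ^ 2 ≤ 1 := by
    rw [EuclideanSpace.norm_sq_eq]
    calc ∑ k, ‖x k‖ ^ 2 ≤ ∑ _k : Fin 3, ((2 : ℝ)⁻¹) ^ 2 :=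
          Finset.sum_le_sum fun k _ => by
            rw [Real.norm_eq_abs]
            exact pow_le_pow_left₀ (abs_nonneg _) (hk k).le 2
      _ ≤ 1 := by norm_num
  nlinarith [norm_nonneg x]

/-- `χ*χ` is continuous (Mathlib: convolution of a locally integrable function with a continuous
compactly supported one). [cite: Fournais2020, (2.4)] -/
theorem IsLocalizationFunction.continuous_selfConv {χ : Space → ℝ} (hχ : IsLocalizationFunction χ) :
    Continuous (selfConv χ) :=
  hχ.hasCompactSupport.continuous_convolution_right _
    hχ.contDiff.continuous.locallyIntegrable hχ.contDiff.continuous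

/-- `χ*χ` is even (Mathlib: convolution of even functions). [cite: Fournais2020, (2.4)] -/
theorem IsLocalizationFunction.selfConv_neg {χ : Space → ℝ} (hχ : IsLocalizationFunction χ)
    (y : Space) : selfConv χ (-y) = selfConv χ y :=
  convolution_neg_of_neg_eq _ (Eventually.of_forall hχ.even) (Eventually.of_forall hχ.even)

/-- `(χ*χ)(0) = ∫ χ² = 1`. [cite: Fournais2020, (2.2), (2.4)] -/
theorem IsLocalizationFunction.selfConv_zero {χ : Space → ℝ} (hχ : IsLocalizationFunction χ) :
    selfConv χ 0 = 1 := by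
  simp only [selfConv_apply, zero_sub, hχ.even, ← sq, hχ.integral_sq]

/-- `g = v(1 - ω) ≥ 0` is dominated by `v`. [cite: Fournais2020, (A.2), (A.4)] -/
theorem IsScatteringSolution.g_le {v : ℝ → ℝ≥0∞} {ω : Space → ℝ} (h : IsScatteringSolution v ω)
    (x : Space) : v ‖x‖ * ENNReal.ofReal (1 - ω x) ≤ v ‖x‖ := by
  refine mul_le_of_le_one_right' ?_
  rw [ENNReal.ofReal_le_one]
  linarith [h.nonneg x]

/-- Under Assumption 1.1 (`∫ v < ∞`), `∫ g < ∞`. [cite: Fournais2020, (A.5)] -/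
theorem IsScatteringSolution.lintegral_g_ne_top {v : ℝ → ℝ≥0∞} {ω : Space → ℝ}
    (h : IsScatteringSolution v ω) (hv : (∫⁻ x : Space, v ‖x‖) ≠ ⊤) :
    (∫⁻ x : Space, v ‖x‖ * ENNReal.ofReal (1 - ω x)) ≠ ⊤ :=
  ne_top_of_le_ne_top hv (lintegral_mono h.g_le)

/-- `χ_u ≥ 0`. [cite: Fournais2020, (2.2)] -/
theorem locFun_nonneg {χ : Space → ℝ} (hχ : IsLocalizationFunction χ) (ℓ : ℝ) (u x : Space) :
    0 ≤ locFun χ ℓ u x :=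
  hχ.nonneg _

/-- `χ_u` is supported in the sliding box `Λ(u)` (indeed in its interior), for `ℓ > 0`.
[cite: Fournais2020, (3.4)–(3.6)] -/
theorem locFun_eq_zero_of_not_mem {χ : Space → ℝ} (hχ : IsLocalizationFunction χ) {ℓ : ℝ}
    (hℓ : 0 < ℓ) {u x : Space} (hx : x ∉ slidingBox ℓ u) : locFun χ ℓ u x = 0 := by
  by_contra h
  have hmem : ℓ⁻¹ • (x - u) ∈ tsupport χ := subset_tsupport _ h
  have hk := hχ.tsupport_subset hmem
  refine hx fun k => ?_
  have := hk k
  rw [PiLp.smul_apply, PiLp.sub_apply, smul_eq_mul, abs_lt, ← div_eq_inv_mul,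
    lt_div_iff₀ hℓ, div_lt_iff₀ hℓ] at this
  constructor <;> linarith

/-- The box `Λ(u)` is a closed, hence measurable, set. [folklore] -/
theorem measurableSet_slidingBox (ℓ : ℝ) (u : Space) : MeasurableSet (slidingBox ℓ u) := by
  have : slidingBox ℓ u = ⋂ k : Fin 3, (fun x : Space => x k - u k) ⁻¹' Set.Icc (-ℓ / 2) (ℓ / 2) := by
    ext x; simp [slidingBox]
  rw [this]
  exact MeasurableSet.iInter fun k => measurableSet_Icc.preimage (by fun_prop)

/-- `Q_u φ` vanishes off `Λ(u)`. [cite: Fournais2020, (3.5)] -/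
theorem projQ_eq_zero_of_not_mem {ℓ : ℝ} {u x : Space} (φ : Space → ℂ) (hx : x ∉ slidingBox ℓ u) :
    projQ ℓ u φ x = 0 :=
  Set.indicator_of_notMem hx _

/-- `Q_u` kills the constants: `Q_u 1 = 0` (for `ℓ > 0`; `|Λ(u)| = ℓ³`). [cite: Fournais2020, (3.5)] -/
theorem projQ_const {ℓ : ℝ} (hℓ : 0 < ℓ) (u : Space) (c : ℂ) : projQ ℓ u (fun _ => c) = 0 := by
  have hvol : volume (slidingBox ℓ u) = ENNReal.ofReal (ℓ ^ 3) := by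
    have h : slidingBox ℓ u = (@ofLp 2 (Fin 3 → ℝ)) ⁻¹'
        (Set.univ.pi fun k => Set.Icc (u k + -ℓ / 2) (u k + ℓ / 2)) := by
      ext x
      simp only [slidingBox, Set.mem_Icc, Set.mem_setOf_eq, Set.mem_preimage, Set.mem_pi,
        Set.mem_univ, forall_const]
      refine forall_congr' fun k => ?_
      constructor <;> rintro ⟨h1, h2⟩ <;> constructor <;> linarith
    rw [h, (PiLp.volume_preserving_ofLp (Fin 3)).measure_preimage
      (MeasurableSet.univ_pi fun _ => measurableSet_Icc).nullMeasurableSet, volume_pi_pi]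
    have hk : ∀ k, u.ofLp k + ℓ / 2 - (u.ofLp k + -ℓ / 2) = ℓ := fun k => by ring
    simp only [Real.volume_Icc, hk, Finset.prod_const, Finset.card_univ, Fintype.card_fin]
    rw [ENNReal.ofReal_pow hℓ.le]
  funext x
  simp only [projQ, Pi.zero_apply]
  by_cases hx : x ∈ slidingBox ℓ u
  · rw [Set.indicator_of_mem hx, setIntegral_const, Measure.real, hvol,
      ENNReal.toReal_ofReal (by positivity), ← smul_assoc, smul_eq_mul,
      inv_mul_cancel₀ (by positivity), one_smul, sub_self]
  · exact Set.indicator_of_notMem hx _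

/-- **Non-vacuity of `IsLocalizationFunction`.** A normalised smooth bump supported in the ball
of radius `¼` is a localisation function. [cite: Fournais2020, (2.2)] -/
theorem exists_isLocalizationFunction : ∃ χ : Space → ℝ, IsLocalizationFunction χ := by
  let f : ContDiffBump (0 : Space) := ⟨8⁻¹, 4⁻¹, by norm_num, by norm_num⟩
  have hf2c : Continuous fun x => (f x) ^ 2 := f.continuous.pow 2
  have hf2s : HasCompactSupport fun x => (f x) ^ 2 := by
    have h := f.hasCompactSupport.mul_left (f := f)
    simp only [sq]
    exact h
  set c : ℝ := ∫ x, (f x) ^ 2 with hc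
  have hc0 : 0 < c := by
    refine hf2c.integral_pos_of_hasCompactSupport_nonneg_nonzero hf2s (fun x => sq_nonneg _)
      (x := 0) ?_
    rw [f.one_of_mem_closedBall (mem_closedBall_self f.rIn_pos.le)]
    norm_num
  refine ⟨fun x => f x / Real.sqrt c, ⟨f.contDiff.div_const _, ?_, ?_, ?_, ?_⟩⟩
  · intro x hx
    have hx' : x ∈ tsupport f := by
      refine tsupport_mul_subset_left (g := fun _ => (Real.sqrt c)⁻¹) ?_
      simpa only [div_eq_mul_inv] using hx
    rw [f.tsupport_eq, mem_closedBall, dist_zero_right] at hx'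
    intro k
    calc |x k| = ‖x k‖ := (Real.norm_eq_abs _).symm
      _ ≤ ‖x‖ := PiLp.norm_apply_le x k
      _ < 2⁻¹ := by
        change ‖x‖ ≤ 4⁻¹ at hx'
        linarith
  · intro x
    simp only [f.neg]
  · intro x
    exact div_nonneg f.nonneg (Real.sqrt_nonneg _)
  · simp only [div_pow, Real.sq_sqrt hc0.le]
    rw [integral_div, ← hc, div_self hc0.ne']

end Literature.MathematicalPhysics.QuantumManyBody.BoseGas

end
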